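import Summits.Ventures.HSemireg.WedgePairRank
import Summits.Ventures.HSemireg.FormulaNStatement

/-!
# Venture HSemireg — glue (1/2): th-6's PointPairLawAt from THEOREM T by reindexing

HONEST FRAMING. Part of the Lean index of the computation cell `pub-hsemireg` (seat p3; Sunday enclosure of the
FORMULA-N kernel assets of seats th-7 / th-6, ENCLOSURE-PLAN-p3.md).  Finite-dimensional exterior algebra over a field ONLY:
no variety, no cohomology theory, no semiregularity map is constructed here; nothing here says that HC / HC_CM / HC_AV holds;
no Literature fact is declared or used.  The geometric DICTIONARY (why these ranks are the `HT`-side box ranks of the cell's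
STRUCTURE.md §1 / theory/FORMULA-N.md) lives in theory/FORMULA-N-th7.md PART B §A.3 / §N and is NOT asserted in Lean.

GLUE of THEOREM T to th-6's typed statements (th-7 theory/th7/PointPairGlue.lean v2 003b351f2923dd2d, Part 3 l.560–759): the
reindexing `eN : (Fin n ⊕ Fin n → K) ≃ₗ (Fin (n+n) → K)` (`inl a ↦ castAdd n a`, `inr a ↦ natAdd n a`) is an isometry of the ZERO
quadratic forms, hence an algebra isomorphism `Φ := CliffordAlgebra.equivOfIsometry isoQ : FormulaN.HT K n ≃ₐ WedgePair.HT K n` with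
`Φ (∂_a) = x_a`, `Φ (dz̄_a) = y_a`; th-6's `E_0`, `E_n` are the ordered block products (`elemClass_zero/top`, `B_X_eq_prod`, `B_Y_eq_prod`
via `orderEmbOfFin` of the blocks = `castAdd` / `natAdd`), so `Φ_vClass_pointPair : Φ (vClass (a,0,…,0,b)) = pointPair a b`; ranks are
`Φ`-invariant (`map_Φ_range_wedgeWith`); RESULT **`pointPairLawAt (hk : k ≤ n) (a b) : FormulaN.PointPairLawAt K n k a b`** and
**`FN4_pointPair_clause`** (= conjunct 3 of th-6's `FN4_classLevel`; its `CharZero` is unused).  th-7's statements and proofs, unchanged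
(namespaces `HSemiregGlue` ↦ `Summit.Ventures.HSemireg.WedgePairGlue`, `HSemiregPointPair` ↦ `….WedgePair`, `HSemiregFormulaN` ↦ `….FormulaN`).
-/

open Module Set Set.powersetCard

namespace Summit.Ventures.HSemireg.WedgePairGlue

variable (K : Type*) [Field K] (n : ℕ)

/-- reindexing `Fin n ⊕ Fin n → K ≃ Fin (n+n) → K` (`inl a ↦ castAdd n a`, `inr a ↦ natAdd n a`). -/
noncomputable def eN : FormulaN.N K n ≃ₗ[K] WedgePair.N K n :=
  LinearEquiv.funCongrLeft K K (finSumFinEquiv.symm : Fin (n + n) ≃ Fin n ⊕ Fin n)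

/-- `eN f j = f (finSumFinEquiv.symm j)`. -/
lemma eN_apply (f : FormulaN.N K n) (j : Fin (n + n)) :
    eN K n f j = f (finSumFinEquiv.symm j) := rfl

/-- `eN` sends the generator `inl a` to `castAdd n a`. -/
lemma eN_single_inl (a : Fin n) :
    eN K n (Pi.single (Sum.inl a) (1 : K)) = Pi.single (Fin.castAdd n a) 1 := by
  ext j
  rw [eN_apply, Pi.single_apply, Pi.single_apply]
  have : finSumFinEquiv.symm j = Sum.inl a ↔ j = Fin.castAdd n a := by
    rw [Equiv.symm_apply_eq]; exact Iff.rfl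
  simp only [this]

/-- `eN` sends the generator `inr a` to `natAdd n a`. -/
lemma eN_single_inr (a : Fin n) :
    eN K n (Pi.single (Sum.inr a) (1 : K)) = Pi.single (Fin.natAdd n a) 1 := by
  ext j
  rw [eN_apply, Pi.single_apply, Pi.single_apply]
  have : finSumFinEquiv.symm j = Sum.inr a ↔ j = Fin.natAdd n a := by
    rw [Equiv.symm_apply_eq]; exact Iff.rfl
  simp only [this]

/-- the reindexing as an isometry of the ZERO quadratic forms. -/
noncomputable def isoQ :
    (0 : QuadraticForm K (FormulaN.N K n)).IsometryEquiv
      (0 : QuadraticForm K (WedgePair.N K n)) :=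
  { eN K n with map_app' := fun m => by simp }

/-- the induced algebra isomorphism of exterior algebras. -/
noncomputable def Φ : FormulaN.HT K n ≃ₐ[K] WedgePair.HT K n :=
  CliffordAlgebra.equivOfIsometry (isoQ K n)

/-- `Φ` on generators is `eN`. -/
lemma Φ_ι (m : FormulaN.N K n) :
    Φ K n (ExteriorAlgebra.ι K m) = ExteriorAlgebra.ι K (eN K n m) := by
  rw [Φ, CliffordAlgebra.equivOfIsometry_apply]
  show CliffordAlgebra.map _ (CliffordAlgebra.ι _ m) = CliffordAlgebra.ι _ _
  rw [CliffordAlgebra.map_apply_ι]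
  rfl

/-- `Φ (∂_a) = e_{castAdd n a}`. -/
lemma Φ_x (a : Fin n) :
    Φ K n (FormulaN.x K n a) = ExteriorAlgebra.ι K (WedgePair.b K n (Fin.castAdd n a)) := by
  rw [FormulaN.x, Φ_ι, eN_single_inl, WedgePair.b, Pi.basisFun_apply]

/-- `Φ (dz̄_a) = e_{natAdd n a}`. -/
lemma Φ_y (a : Fin n) :
    Φ K n (FormulaN.y K n a) = ExteriorAlgebra.ι K (WedgePair.b K n (Fin.natAdd n a)) := by
  rw [FormulaN.y, Φ_ι, eN_single_inr, WedgePair.b, Pi.basisFun_apply]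

/-! ### th-6's elementary classes `E_0`, `E_n` and the point-pair `vClass` -/

/-- th-6's `E_0` is the ordered product of the `∂_a`. -/
lemma elemClass_zero :
    FormulaN.elemClass K n 0 = ((List.finRange n).map (FormulaN.x K n)).prod := by
  simp only [FormulaN.elemClass, Finset.powersetCard_zero, Finset.sum_singleton, Finset.notMem_empty,
    if_false]

/-- th-6's `E_n` is the ordered product of the `dz̄_a`. -/
lemma elemClass_top :
    FormulaN.elemClass K n n = ((List.finRange n).map (FormulaN.y K n)).prod := by
  have h : (Finset.univ : Finset (Fin n)).powersetCard n = {Finset.univ} := by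
    ext s
    simp only [Finset.mem_powersetCard, Finset.subset_univ, true_and, Finset.mem_singleton]
    constructor
    · intro hs
      exact Finset.eq_univ_of_card s (by rw [hs, Fintype.card_fin])
    · rintro rfl
      rw [Finset.card_univ, Fintype.card_fin]
  simp only [FormulaN.elemClass, h, Finset.sum_singleton, Finset.mem_univ, if_true]

/-- for `q = (a,0,…,0,b)` th-6's `vClass q = a•E_0 + b•E_n` (needs `1 ≤ n`). -/
lemma vClass_pointPair (hn : 1 ≤ n) (a b : K) :
    FormulaN.vClass K n (fun m => (if m = 0 then a else 0) + (if m = n then b else 0)) =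
      a • FormulaN.elemClass K n 0 + b • FormulaN.elemClass K n n := by
  rw [FormulaN.vClass]
  rw [Finset.sum_eq_add_of_mem (0 : ℕ) n (by simp) (by simp) (by omega)]
  · have h1 : (0 : ℕ) ≠ n := by omega
    have h2 : n ≠ 0 := by omega
    simp only [if_neg h1, if_neg h2, if_true, add_zero, zero_add]
  · intro m _ hm
    rw [if_neg hm.1, if_neg hm.2, add_zero, zero_smul]

/-! ### th-7's monomials `E_X`, `E_Y` as ordered products -/

/-- the order embedding enumerating the `X` block is `castAdd`. -/
lemma orderEmb_X :
    ((ofFinEmbEquiv.symm (WedgePair.Xpc n) : Fin n ↪o WedgePair.I n) : Fin n → WedgePair.I n)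
      = Fin.castAdd n := by
  rw [ofFinEmbEquiv_symm_apply]
  symm
  apply Finset.orderEmbOfFin_unique
  · intro i
    show Fin.castAdd n i ∈ WedgePair.Xset n
    rw [WedgePair.mem_Xset]
    simp
  · exact Fin.strictMono_castAdd n

/-- the order embedding enumerating the `Y` block is `natAdd`. -/
lemma orderEmb_Y :
    ((ofFinEmbEquiv.symm (WedgePair.Ypc n) : Fin n ↪o WedgePair.I n) : Fin n → WedgePair.I n)
      = Fin.natAdd n := by
  rw [ofFinEmbEquiv_symm_apply]
  symm
  apply Finset.orderEmbOfFin_unique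
  · intro i
    show Fin.natAdd n i ∈ WedgePair.Yset n
    rw [WedgePair.mem_Yset]
    simp
  · exact Fin.strictMono_natAdd n

/-- `E_X` is the ordered product of the `x`-generators. -/
lemma B_X_eq_prod :
    WedgePair.B K n (WedgePair.Xpc n : powersetCard (WedgePair.I n) n) =
      ((List.finRange n).map fun i => ExteriorAlgebra.ι K (WedgePair.b K n (Fin.castAdd n i))).prod := by
  rw [WedgePair.B_apply_pc, ExteriorAlgebra.basis_apply_powersetCard]
  show ExteriorAlgebra.ιMulti K n _ = _
  rw [ExteriorAlgebra.ιMulti_apply, List.ofFn_eq_map]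
  congr 1
  apply List.map_congr_left
  intro i _
  show ExteriorAlgebra.ι K (WedgePair.b K n ((ofFinEmbEquiv.symm (WedgePair.Xpc n)) i)) = _
  rw [show ((ofFinEmbEquiv.symm (WedgePair.Xpc n)) i) = Fin.castAdd n i from
    congrFun (orderEmb_X n) i]

/-- `E_Y` is the ordered product of the `y`-generators. -/
lemma B_Y_eq_prod :
    WedgePair.B K n (WedgePair.Ypc n : powersetCard (WedgePair.I n) n) =
      ((List.finRange n).map fun i => ExteriorAlgebra.ι K (WedgePair.b K n (Fin.natAdd n i))).prod := by
  rw [WedgePair.B_apply_pc, ExteriorAlgebra.basis_apply_powersetCard]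
  show ExteriorAlgebra.ιMulti K n _ = _
  rw [ExteriorAlgebra.ιMulti_apply, List.ofFn_eq_map]
  congr 1
  apply List.map_congr_left
  intro i _
  show ExteriorAlgebra.ι K (WedgePair.b K n ((ofFinEmbEquiv.symm (WedgePair.Ypc n)) i)) = _
  rw [show ((ofFinEmbEquiv.symm (WedgePair.Ypc n)) i) = Fin.natAdd n i from
    congrFun (orderEmb_Y n) i]

/-- the reindexing carries th-6's point-pair class to th-7's `pointPair`. -/
lemma Φ_vClass_pointPair (hn : 1 ≤ n) (a b : K) :
    Φ K n (FormulaN.vClass K n (fun m => (if m = 0 then a else 0) + (if m = n then b else 0))) =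
      WedgePair.pointPair K n a b := by
  rw [vClass_pointPair K n hn, map_add, map_smul, map_smul, elemClass_zero, elemClass_top, map_list_prod,
    map_list_prod, List.map_map, List.map_map, WedgePair.pointPair, B_X_eq_prod, B_Y_eq_prod]
  congr 3
  · exact List.map_congr_left fun i _ => Φ_x K n i
  · exact List.map_congr_left fun i _ => Φ_y K n i

/-! ### transporting the range and its dimension -/

/-- `Φ` maps the generators onto the generators. -/
lemma map_Φ_range_ι :
    Submodule.map (Φ K n).toLinearMap (LinearMap.range (ExteriorAlgebra.ι K : FormulaN.N K n →ₗ[K] _)) =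
      LinearMap.range (ExteriorAlgebra.ι K : WedgePair.N K n →ₗ[K] _) := by
  rw [← LinearMap.range_comp]
  have h : (Φ K n).toLinearMap ∘ₗ (ExteriorAlgebra.ι K : FormulaN.N K n →ₗ[K] _) =
      (ExteriorAlgebra.ι K : WedgePair.N K n →ₗ[K] _) ∘ₗ (eN K n).toLinearMap := by
    refine LinearMap.ext fun m => ?_
    simp only [LinearMap.coe_comp, Function.comp_apply, LinearEquiv.coe_coe]
    exact Φ_ι K n m
  rw [h, LinearMap.range_comp_of_range_eq_top _ (LinearEquiv.range (eN K n))]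

/-- `Φ` maps `⋀^k` onto `⋀^k`. -/
lemma map_Φ_exteriorPower (k : ℕ) :
    Submodule.map (Φ K n).toLinearMap (⋀[K]^k (FormulaN.N K n)) = ⋀[K]^k (WedgePair.N K n) := by
  show Submodule.map (Φ K n).toAlgHom.toLinearMap (LinearMap.range (ExteriorAlgebra.ι K) ^ k) =
    LinearMap.range (ExteriorAlgebra.ι K) ^ k
  rw [Submodule.map_pow, show (Φ K n).toAlgHom.toLinearMap = (Φ K n).toLinearMap from rfl, map_Φ_range_ι]

/-- `Φ` carries the range of th-6's `wedgeWith k q` onto the range of `wedge k (Φ (vClass q))`. -/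
lemma map_Φ_range_wedgeWith (k : ℕ) (q : ℕ → K) :
    Submodule.map (Φ K n).toLinearMap (LinearMap.range (FormulaN.wedgeWith K n k q)) =
      LinearMap.range (WedgePair.wedgeMap K n k (Φ K n (FormulaN.vClass K n q))) := by
  rw [FormulaN.wedgeWith, WedgePair.wedgeMap, LinearMap.range_comp, LinearMap.range_comp,
    Submodule.range_subtype, Submodule.range_subtype, ← map_Φ_exteriorPower K n k, ← Submodule.map_comp,
    ← Submodule.map_comp]
  congr 1
  refine LinearMap.ext fun x => ?_
  simp only [LinearMap.coe_comp, Function.comp_apply, LinearMap.mulRight_apply, AlgEquiv.toLinearMap_apply,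
    map_mul]

/-- **th-6's `PointPairLawAt`, PROVED** for every field, every `n ≥ 1`, every `k ≤ n`. -/
theorem pointPairLawAt {k : ℕ} (hk : k ≤ n) (a b : K) : FormulaN.PointPairLawAt K n k a b := by
  intro ha hb hn
  have h1 : Module.finrank K (LinearMap.range (FormulaN.wedgeWith K n k
      fun m => (if m = 0 then a else 0) + (if m = n then b else 0))) =
      Module.finrank K (Submodule.map (Φ K n).toLinearMap (LinearMap.range (FormulaN.wedgeWith K n k
        fun m => (if m = 0 then a else 0) + (if m = n then b else 0)))) :=
    (LinearEquiv.finrank_map_eq (Φ K n).toLinearEquiv _).symm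
  rw [h1, map_Φ_range_wedgeWith, Φ_vClass_pointPair K n hn,
    WedgePair.finrank_range_wedgeMap_pointPair K (by omega) hk ha hb]
  rfl

/-- the third conjunct of th-6's `FN4_classLevel`, discharged. -/
theorem FN4_pointPair_clause :
    ∀ (K : Type) [Field K] [CharZero K] (n k : ℕ) (a b : K), k ≤ n → FormulaN.PointPairLawAt K n k a b :=
  fun K _ _ n _ a b hk => pointPairLawAt K n hk a b

/-! ## Part 4 — th-6's `TransversePairLawAt` (two finite exponentials), PROVED for `n ≥ 1`, `k ≤ n`
(th-6's statement lacks the `1 ≤ n` guard and is false at `n = k = 0`; we prove it under `1 ≤ n`).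
Route: the shear `x_a ↦ x_a + λ y_a`, `y_a ↦ x_a + μ y_a` (invertible iff `λ ≠ μ`) is an isometry of the
zero form, hence induces an algebra automorphism `Ψ` of `⋀N`; by the ORDERED binomial expansion
`Π_a (x_a + λ y_a) = Σ_m λ^m E_m` it carries the point pair `A·E_0 + B·E_n` to `vClass (A λ^m + B μ^m)`;
ranks of `θ ↦ θ ∧ v` on `⋀^k` are invariant under `Ψ`. -/

end Summit.Ventures.HSemireg.WedgePairGlue
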